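import Literature.Computability.Cryptography.GoldreichLevinHiding
import Literature.Computability.Cryptography.AffineHashStrings
import Literature.Computability.Cryptography.LiuPassCondFromRegular
import HarnessLib

/-!
# Liu–Pass Lemma 5.3: the construction (`f'_i`, `GL`, the hiding core `g`) and its bookkeeping

Third level of the decomposition of `condEPPRG_of_OWFExist` (Liu–Pass, FOCS 2020, Thm 5.5).
`LiuPassCondFromRegular.lean` proves Thm 5.5 from **Lemma 5.3** (named fact `liuPass_lemma53`:
from a regular `𝒮`-one-way `f`, an efficiently computable family `f'_i` and hard-core bits `GL`
with the printed *density* and *pseudorandomness*). The printed proof (arXiv:2009.11514, Appendix)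
takes

  `f'_i(x, σ₁, σ₂, σ_GL) = σ_GL ‖ σ₁ ‖ σ₂ ‖ [h_{σ₁}(x)]_a ‖ [h_{σ₂}(f x)]_b`,  `GL(x, σ_GL)` = inner products,

with Carter–Wegman hashing, the Leftover Hash Lemma (density) and Goldreich–Levin for `𝒮`-hiding
functions (pseudorandomness). This file **defines** that construction in the tree's terms and
proves its elementary bookkeeping; the density (`LiuPassLemma53Density.lean`), the hiding claim,
efficiency and the assembly follow in sibling files. Everything here is proved.

## The rendering (documented deviations from print)

* Parameters `Q : L53Params` = `(f, P, α', γ')` with `P` a polynomial *intended* to bound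
  `|f x| ≤ P(|x|)`. That bound is **not** a field of the structure and nothing in this file uses
  it: it is taken as an explicit hypothesis where needed (injectivity of `pad`, hence density;
  the hiding reduction). The seed exponent is `c = deg P + 3` (print: "there exists a constant
  `c`"), so that the three regions below fit into `3n^c` bits for all large `n`.
* On a seed `w = x ‖ τ` (`x ∈ S_n`, `|τ| = 3n^c`, the set `lpSeeds S c n`): `τ = ρ ‖ σ` with `σ` the
  **last** `k·n` bits (`k = γ'⌊log₂ n⌋`, the Goldreich–Levin seed: `GL(x, σ) = glBits k n x σ`) and
  `ρ = R₁ ‖ R₂ ‖ junk`, `|R₁| = n(n+1)` (key of `h¹ : {0,1}ⁿ → 𝔽₂^a`), `|R₂| = n(M+1)` (key of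
  `h² : {0,1}^M → 𝔽₂^b`, applied to `f x` padded to length `M = P(n) + 1`, injectively when `|f x| ≤ P(n)`), both in the
  layout of `Stockmeyer.coinHash` (`AffineHashStrings.lean`).
* Hash lengths: with `L = (n − ⌊log₂ n⌋ − 1) − 2α'⌊log₂ n⌋` (`= lpLen53 − 3n^c`) we take
  `a = min i L`, `b = L − a` (print: `a = i − α' log n`, `b = s(n) − i − α' log n`; the one-shot
  collision bound of `LeftoverHashJoint.lean` lets all the slack sit on one side, which is what makes
  the printed constant `3/n^{α'/2}` attainable with integer logarithms, and `min` keeps the output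
  length right for *every* index `i`).
* The hiding core `g(x ‖ ρ) = ρ ‖ h¹_{R₁}(x) ‖ h²_{R₂}(pad (f x))` and
  `f'_i(x ‖ τ) = g(x ‖ ρ) ‖ σ` (`L53Params.F`), `GL = glBits` (`L53Params.Hc`): so that
  `f'_{r(n)}(w) ‖ GL(w) = glReal g (m n) k n w` is literally the real sample of the Goldreich–Levin
  fact `goldreichLevin_hiding` (`F_append_Hc_eq_glReal`). Block order differs from print
  (`σ_GL` last instead of first) — harmless, as recorded in `GoldreichLevinHiding.lean`.
* `F` recovers `n` from `|w| = n + 3n^c` (`nOf`, exact: `nOf_eq`); `g` — which need not be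
  efficient — recovers `n` from `|x ‖ ρ| = n + m(n)` by `Nat.findGreatest` (`nOfG`), correct for all
  large `n` (`nOfG_eq`: `n ↦ n + m n` is eventually strictly increasing).

## References

* Y. Liu, R. Pass, *On one-way functions and Kolmogorov complexity*, FOCS 2020
  (arXiv:2009.11514), Lemma 5.3 and Appendix (its proof).
* O. Goldreich, *Foundations of Cryptography I*, CUP 2001, §3.5 (the regular-OWF construction).
-/

namespace Literature.Computability.Cryptography

open Finset Filter _root_.Computability Complexity AffineStr

/-- The data of Lemma 5.3's construction: the function `f`, a polynomial `P` (sizing the padded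
output length `M = P(n) + 1`; the bound `|f x| ≤ P(|x|)` itself is *not* recorded here and is an
explicit hypothesis of the results that need it), and the two parameters `α', γ'` of the lemma.
[Y. Liu, R. Pass, FOCS 2020, Lemma 5.3] [folklore] -/
structure L53Params where
  /-- the (`𝒮`-one-way) function [folklore] -/
  f : List Bool → List Bool
  /-- the polynomial sizing `M = P(n) + 1` (meant as an output-length bound `|f x| ≤ P |x|`,
  assumed separately where needed) [folklore] -/
  P : Polynomial ℕ
  /-- the density/security parameter `α'` [folklore] -/
  α' : ℕ
  /-- the stretch parameter `γ'` (number of hard-core bits `γ'⌊log₂ n⌋`) [folklore] -/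
  γ' : ℕ

namespace L53Params

variable (Q : L53Params)

/-! ### Lengths -/

/-- Seed exponent `c = deg P + 3`. [folklore] -/
def c : ℕ := Q.P.natDegree + 3
/-- Number of hard-core bits `k = γ'⌊log₂ n⌋`. [folklore] -/
def kk (n : ℕ) : ℕ := Q.γ' * Nat.log 2 n
/-- Extracted bits `L = s(n) − 2α'⌊log₂ n⌋`, `s(n) = n − ⌊log₂ n⌋ − 1` (`lpS53`). [folklore] -/
def L (n : ℕ) : ℕ := lpS53 n - 2 * Q.α' * Nat.log 2 n
/-- Padded length `M = P(n) + 1` of `f x`. [folklore] -/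
def M (n : ℕ) : ℕ := Q.P.eval n + 1
/-- Key length of `h¹` (`a ≤ n` rows of `n + 1` bits). [folklore] -/
def R₁ (n : ℕ) : ℕ := n * (n + 1)
/-- Key length of `h²` (`b ≤ n` rows of `M + 1` bits). [folklore] -/
def R₂ (n : ℕ) : ℕ := n * (Q.M n + 1)
/-- `|τ| = 3n^c`. [folklore] -/
def tot (n : ℕ) : ℕ := 3 * n ^ Q.c
/-- `|ρ| = 3n^c − k·n`. [folklore] -/
def m (n : ℕ) : ℕ := Q.tot n - Q.kk n * n
/-- First hash length `a = min i L`. [folklore] -/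
def aOf (i n : ℕ) : ℕ := min i (Q.L n)
/-- Second hash length `b = L − a`. [folklore] -/
def bOf (i n : ℕ) : ℕ := Q.L n - Q.aOf i n

/-- `a + b = L`. [folklore] -/
theorem aOf_add_bOf (i n : ℕ) : Q.aOf i n + Q.bOf i n = Q.L n := by
  unfold bOf aOf; omega

/-- `a ≤ i`. [folklore] -/
theorem aOf_le (i n : ℕ) : Q.aOf i n ≤ i := min_le_left _ _

/-- `L ≤ n`. [folklore] -/
theorem L_le (n : ℕ) : Q.L n ≤ n := by unfold L lpS53; omega

/-! ### The maps -/

/-- Padding of `f x` to the fixed length `M = P(n) + 1`: `y ↦ (y ‖ 1 ‖ 0…) ↾ M`. It is injective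
**on `{y : |y| ≤ P(n)}`** only (`CondParams.fitLen` truncates longer strings) — the regime
`|f x| ≤ P(|x|)` that the density file takes as a hypothesis. [folklore] -/
def pad (n : ℕ) (y : List Bool) : List Bool := CondParams.fitLen (y ++ [true]) (Q.M n)

/-- **The hiding core on `(x, ρ)`**: `ρ ‖ h¹_{R₁}(x) ‖ h²_{R₂}(pad (f x))` with `R₁ = ρ ↾ n(n+1)`,
`R₂` the next `n(M+1)` bits. [Y. Liu, R. Pass, FOCS 2020, Appendix (`f_i(x, σ₁, σ₂)`)]
[cite: LiuPassFOCS2020, Lemma 5.3 (proof, Appendix)] -/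
def gcore (n i : ℕ) (x ρ : List Bool) : List Bool :=
  ρ ++ hashStr n (Q.aOf i n) (ρ.take (R₁ n)) x ++
    hashStr (Q.M n) (Q.bOf i n) ((ρ.drop (R₁ n)).take (Q.R₂ n)) (Q.pad n (Q.f x))

/-- `n` from the seed length `n + 3n^c` (largest `n` with `n + 3n^c ≤ ℓ`). [folklore] -/
def nOf (ℓ : ℕ) : ℕ := Nat.findGreatest (fun n => n + Q.tot n ≤ ℓ) ℓ

/-- **The family `f'_i`** on seeds `w = x ‖ ρ ‖ σ`: `g(x ‖ ρ) ‖ σ`. [Y. Liu, R. Pass, FOCS 2020,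
Lemma 5.3 / Appendix (`f'_i = σ_GL ‖ f_i`)] [cite: LiuPassFOCS2020, Lemma 5.3 (proof, Appendix)] -/
def F (i : ℕ) (w : List Bool) : List Bool :=
  Q.gcore (Q.nOf w.length) i (w.take (Q.nOf w.length)) ((w.drop (Q.nOf w.length)).take (Q.m (Q.nOf w.length))) ++
    (w.drop (Q.nOf w.length)).drop (Q.m (Q.nOf w.length))

/-- **The hard-core function** `GL(w) = glBits k n x σ`. [Y. Liu, R. Pass, FOCS 2020, Lemma 5.3 /
Appendix ("`γ' log n` inner products between `x` and vectors in `σ_GL`")]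
[cite: LiuPassFOCS2020, Lemma 5.3 (proof, Appendix)] -/
def Hc (w : List Bool) : List Bool :=
  glBits (Q.kk (Q.nOf w.length)) (Q.nOf w.length) (w.take (Q.nOf w.length))
    ((w.drop (Q.nOf w.length)).drop (Q.m (Q.nOf w.length)))

/-- `n` from the length `n + m n` of `x ‖ ρ` (largest solution; correct for large `n`, `nOfG_eq`).
[folklore] -/
def nOfG (ℓ : ℕ) : ℕ := Nat.findGreatest (fun n => n + Q.m n = ℓ) ℓ

/-- **The hiding function `g` of the Goldreich–Levin step** (indexed by the regularity `r`):
`g(x ‖ ρ) = gcore n (r n) x ρ`. Not required to be efficient. [Y. Liu, R. Pass, FOCS 2020, Appendix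
(`f̂(x, (σ₁,σ₂)) = f_{r(n)}(x, σ₁, σ₂)`)] [cite: LiuPassFOCS2020, Lemma 5.3 (proof, Appendix)] -/
def g (r : ℕ → ℕ) (w : List Bool) : List Bool :=
  Q.gcore (Q.nOfG w.length) (r (Q.nOfG w.length)) (w.take (Q.nOfG w.length)) (w.drop (Q.nOfG w.length))

/-! ### Recovering `n` -/

/-- `1 ≤ c`. [folklore] -/
theorem one_le_c : 1 ≤ Q.c := by unfold c; omega

/-- `n ↦ n + 3n^c` is strictly increasing. [folklore] -/
theorem strictMono_add_tot : StrictMono fun n => n + Q.tot n := by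
  refine strictMono_nat_of_lt_succ fun n => ?_
  unfold tot
  have : n ^ Q.c ≤ (n + 1) ^ Q.c := Nat.pow_le_pow_left (Nat.le_succ n) _
  omega

/-- **`nOf` inverts the seed length**: `nOf (n + 3n^c) = n`. [folklore] -/
theorem nOf_eq (n : ℕ) : Q.nOf (n + Q.tot n) = n := by
  unfold nOf
  apply le_antisymm
  · by_contra h
    push Not at h
    have hspec := Nat.findGreatest_spec (P := fun n' => n' + Q.tot n' ≤ n + Q.tot n) (m := n) (n := n + Q.tot n)
      (Nat.le_add_right _ _) le_rfl
    have := Q.strictMono_add_tot h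
    simp only at hspec this
    omega
  · exact Nat.le_findGreatest (Nat.le_add_right _ _) le_rfl

/-- Members of `lpSeeds S c n` have length `n + 3n^c`. [folklore] -/
theorem length_of_mem_lpSeeds' {S : ∀ n : ℕ, Finset (List.Vector Bool n)} {n : ℕ} {w : List Bool}
    (hw : w ∈ lpSeeds S Q.c n) : w.length = n + Q.tot n := by
  rw [CondParams.length_of_mem_lpSeeds (S := S) hw]; rfl

/-- `(n+1)^c ≥ n^c + n²` for `c ≥ 3`. [folklore] -/
theorem pow_succ_ge (n : ℕ) : n ^ Q.c + n ^ 2 ≤ (n + 1) ^ Q.c := by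
  have hc : 3 ≤ Q.c := by unfold c; omega
  obtain ⟨d, hd⟩ : ∃ d, Q.c = d + 1 := ⟨Q.c - 1, by omega⟩
  rw [hd]
  rcases Nat.eq_zero_or_pos n with rfl | hn
  · simp
  have h1 : n ^ d ≤ (n + 1) ^ d := Nat.pow_le_pow_left (Nat.le_succ n) _
  calc n ^ (d + 1) + n ^ 2 ≤ n ^ (d + 1) + n ^ d := Nat.add_le_add_left (Nat.pow_le_pow_right hn (by omega)) _
    _ = n ^ d * (n + 1) := by ring
    _ ≤ (n + 1) ^ d * (n + 1) := Nat.mul_le_mul_right _ h1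
    _ = (n + 1) ^ (d + 1) := by ring

/-- No truncation in `m n = 3n^c − k n` once `n ≥ γ'`. [folklore] -/
theorem kk_mul_le_tot {n : ℕ} (hn : Q.γ' ≤ n) : Q.kk n * n ≤ Q.tot n := by
  unfold kk tot
  have hc : 3 ≤ Q.c := by unfold c; omega
  have hlog : Nat.log 2 n ≤ n := Nat.log_le_self 2 n
  have hpow : n ^ 3 ≤ n ^ Q.c := by
    rcases Nat.eq_zero_or_pos n with rfl | hpos
    · simp
    · exact Nat.pow_le_pow_right hpos hc
  calc Q.γ' * Nat.log 2 n * n ≤ n * n * n := by gcongr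
    _ = n ^ 3 := by ring
    _ ≤ 3 * n ^ Q.c := by omega

/-- **`n ↦ n + m n` is strictly increasing from `γ'` on** (one step). [folklore] -/
theorem add_m_lt_succ {n : ℕ} (hn : Q.γ' ≤ n) : n + Q.m n < (n + 1) + Q.m (n + 1) := by
  have h0 := Q.kk_mul_le_tot hn
  have h1 := Q.kk_mul_le_tot (Nat.le_succ_of_le hn)
  have hp := Q.pow_succ_ge n
  have hl := log_two_succ_le n
  unfold m at *
  unfold kk tot at *
  -- `γ' Λ' (n+1) ≤ γ' (Λ + 1)(n + 1) = γ' Λ n + γ'(Λ + n + 1)` and `3 n² ≥ γ' (2n + 1)`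
  have h2 : Q.γ' * Nat.log 2 (n + 1) * (n + 1) ≤ Q.γ' * Nat.log 2 n * n + Q.γ' * (Nat.log 2 n + n + 1) := by
    calc Q.γ' * Nat.log 2 (n + 1) * (n + 1) ≤ Q.γ' * (Nat.log 2 n + 1) * (n + 1) := by gcongr
      _ = Q.γ' * Nat.log 2 n * n + Q.γ' * (Nat.log 2 n + n + 1) := by ring
  have hlog : Nat.log 2 n ≤ n := Nat.log_le_self 2 n
  have h3 : Q.γ' * (Nat.log 2 n + n + 1) ≤ 3 * n ^ 2 := by
    calc Q.γ' * (Nat.log 2 n + n + 1) ≤ n * (n + n + 1) := by gcongr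
      _ ≤ 3 * n ^ 2 := by nlinarith
  omega

/-- Strict monotonicity of `n ↦ n + m n` on `[γ', ∞)`. [folklore] -/
theorem add_m_lt_of_lt {a b : ℕ} (ha : Q.γ' ≤ a) (hab : a < b) : a + Q.m a < b + Q.m b := by
  induction b with
  | zero => omega
  | succ b ih =>
    rcases Nat.lt_succ_iff_lt_or_eq.1 hab with h | rfl
    · exact (ih h).trans (Q.add_m_lt_succ (by omega))
    · exact Q.add_m_lt_succ ha

/-- **`nOfG` inverts `n ↦ n + m n` for `n ≥ γ'`.** [folklore] -/
theorem nOfG_eq {n : ℕ} (hn : Q.γ' ≤ n) : Q.nOfG (n + Q.m n) = n := by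
  unfold nOfG
  apply le_antisymm
  · by_contra h
    push Not at h
    have hspec := Nat.findGreatest_spec (P := fun n' => n' + Q.m n' = n + Q.m n) (m := n) (n := n + Q.m n)
      (Nat.le_add_right _ _) rfl
    have := Q.add_m_lt_of_lt hn h
    omega
  · exact Nat.le_findGreatest (Nat.le_add_right _ _) rfl

/-- Eventual form of `nOfG_eq`. [folklore] -/
theorem eventually_nOfG_eq : ∀ᶠ n in atTop, Q.nOfG (n + Q.m n) = n := by
  filter_upwards [eventually_ge_atTop Q.γ'] with n hn using Q.nOfG_eq hn

/-! ### Lengths of the outputs -/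

/-- `|pad n y| = M n`. [folklore] -/
@[simp] theorem length_pad (n : ℕ) (y : List Bool) : (Q.pad n y).length = Q.M n := CondParams.length_fitLen _ _

/-- `|gcore n i x ρ| = |ρ| + L n`. [folklore] -/
theorem length_gcore (n i : ℕ) (x ρ : List Bool) : (Q.gcore n i x ρ).length = ρ.length + Q.L n := by
  simp only [gcore, List.length_append, length_hashStr, ← Q.aOf_add_bOf i n]; omega

/-- `|GL w| = k n`. [folklore] -/
theorem length_Hc (w : List Bool) : (Q.Hc w).length = Q.kk (Q.nOf w.length) := by
  simp [Hc]

/-- **`|f'_i(w)| = 3n^c + L n` on seeds of length `n + 3n^c`.** [folklore] -/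
theorem length_F {i n : ℕ} {w : List Bool} (hw : w.length = n + Q.tot n) : (Q.F i w).length = Q.tot n + Q.L n := by
  have hn : Q.nOf (n + Q.tot n) = n := Q.nOf_eq n
  simp only [F, hw, hn, List.length_append, Q.length_gcore, List.length_take, List.length_drop]
  have : Q.m n ≤ Q.tot n := Nat.sub_le _ _
  omega

/-- The printed output length: `lpLen53 c α' n = 3n^c + L n` once `2α'⌊log₂ n⌋ ≤ s(n)`. [folklore] -/
theorem lpLen53_eq {n : ℕ} (hn : 2 * Q.α' * Nat.log 2 n ≤ lpS53 n) : lpLen53 Q.c Q.α' n = Q.tot n + Q.L n := by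
  unfold lpLen53 L tot; omega

/-- Eventually `2α'⌊log₂ n⌋ ≤ s(n)`. [folklore] -/
theorem eventually_slack : ∀ᶠ n in atTop, 2 * Q.α' * Nat.log 2 n ≤ lpS53 n := by
  filter_upwards [eventually_mul_log_add_le (2 * Q.α' + 2)] with n hn
  unfold lpS53
  have ht : (2 * Q.α' + 2) * Nat.log 2 n = 2 * (Q.α' * Nat.log 2 n) + 2 * Nat.log 2 n := by ring
  rw [ht] at hn
  rw [Nat.mul_assoc]
  generalize Q.α' * Nat.log 2 n = t at hn ⊢
  omega

/-- **The lengths required by Lemma 5.3, eventually**: `|f'_{r n}(w)| = lpLen53 c α' n` and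
`|GL(w)| = γ'⌊log₂ n⌋` for all seeds `w ∈ lpSeeds S c n`. [Y. Liu, R. Pass, FOCS 2020, Lemma 5.3
("`f'` maps `n' = n + 3n^c` bits to `3n^c + s(n) − 2α' log n` bits")] [folklore] -/
theorem eventually_lengths (S : ∀ n : ℕ, Finset (List.Vector Bool n)) (r : ℕ → ℕ) :
    ∀ᶠ n in atTop, ∀ w ∈ lpSeeds S Q.c n, (Q.F (r n) w).length = lpLen53 Q.c Q.α' n ∧ (Q.Hc w).length = Q.γ' * Nat.log 2 n := by
  filter_upwards [Q.eventually_slack] with n hn w hw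
  have hl := Q.length_of_mem_lpSeeds' hw
  refine ⟨by rw [Q.length_F hl, Q.lpLen53_eq hn], ?_⟩
  rw [Q.length_Hc, hl, Q.nOf_eq]; rfl

/-! ### `f'_{r n} ‖ GL` is the real sample of the Goldreich–Levin fact -/

/-- The seeds of Lemma 5.3 are the block seeds of the Goldreich–Levin fact with `ρ`-length `m n`
and `k n` blocks, once `k n · n ≤ 3n^c`. [folklore] -/
theorem lpSeeds_eq_blockSeeds (S : ∀ n : ℕ, Finset (List.Vector Bool n)) {n : ℕ} (hn : Q.γ' ≤ n) :
    lpSeeds S Q.c n = blockSeeds S (Q.m n + Q.kk n * n) n := by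
  have h : Q.m n + Q.kk n * n = 3 * n ^ Q.c := by
    have := Q.kk_mul_le_tot hn; unfold m; unfold tot at *; omega
  rw [h]; rfl

/-- **`f'_{r n}(w) ‖ GL(w) = glReal (g r) (m n) (k n) n w`** on every seed of length `n + 3n^c`,
`n ≥ γ'`: the concatenation handed to the distinguishers of Lemma 5.3 is literally the real sample of
`goldreichLevin_hiding` for the hiding function `g r`. [Y. Liu, R. Pass, FOCS 2020, Appendix
(pseudorandomness: "by Theorem (thm:GL), the following ensembles are indistinguishable")] [folklore] -/
theorem F_append_Hc_eq_glReal (r : ℕ → ℕ) {n : ℕ} (hn : Q.γ' ≤ n) {w : List Bool} (hw : w.length = n + Q.tot n) :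
    Q.F (r n) w ++ Q.Hc w = glReal (Q.g r) (Q.m n) (Q.kk n) n w := by
  have hN : Q.nOf w.length = n := by rw [hw, Q.nOf_eq]
  have hmt : Q.m n + Q.kk n * n = Q.tot n := by
    have := Q.kk_mul_le_tot hn; unfold m; omega
  have hlen' : (w.take (n + Q.m n)).length = n + Q.m n := by
    rw [List.length_take, hw]; exact min_eq_left (by omega)
  have hG : Q.nOfG (w.take (n + Q.m n)).length = n := by rw [hlen', Q.nOfG_eq hn]
  have h1 : (w.take (n + Q.m n)).take n = w.take n := by
    rw [List.take_take, min_eq_left (Nat.le_add_right _ _)]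
  have h2 : (w.take (n + Q.m n)).drop n = (w.drop n).take (Q.m n) := by
    rw [List.drop_take, Nat.add_sub_cancel_left]
  have h3 : (w.drop (n + Q.m n)).take (Q.kk n * n) = w.drop (n + Q.m n) := by
    apply List.take_of_length_le
    rw [List.length_drop, hw]; omega
  have h4 : (w.drop n).drop (Q.m n) = w.drop (n + Q.m n) := by rw [List.drop_drop]
  simp only [F, Hc, g, hN, glReal, hG, h1, h2, h3, h4, List.append_assoc]

end L53Params

end Literature.Computability.Cryptography
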